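import Literature.NumberTheory.DiophantineGeometry.StewartYuPadicLogFormsProofs
import HarnessLib.Audit.Tags

set_option linter.dupNamespace false

/-!
# Theorem A₁ — the p-adic principal-unit analogue of Waldschmidt 1980, stated as an open named conjecture

Cell `abc-stewartyu` (human ruling D-0046; rung ladder F-A1, D-0059/D-0061). `TheoremAOne` is, VERBATIM, the
statement of the route item `Summit.ABC.ABC.Theses.PadicPrincipalCoreST86.TheoremAOne` (= the crux of the ε-rung
route `PadicPrincipalCoreRadThree`): a lower bound for a non-vanishing p-adic linear form Λ = Σ bⱼ log_p αⱼ in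
PRINCIPAL units αⱼ ≡ 1 (mod p) of ℚ (p odd), multiplicatively independent and Kummer-free, of Waldschmidt-1980
shape `ord_p(∏ αⱼ^bⱼ − 1)·log p ≤ C(m)·V₁⋯V_m·(W + log(2V_m))·log(2V_m)/(log p)^r(m)` with envelope
`C(m) ≤ c₁^m · m^(c₂ m)`, `c₂ ≤ 1` (the exponent of Waldschmidt's archimedean U). It is this programme's p-adic
transposition (Yu 1989 §2 architecture for principal units; Cijsouw–Waldschmidt 1977 / Waldschmidt 1980
interpolation determinant), NOT a published theorem: stated 2026-08-25 by the cell; two end-to-end kernel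
certificates exist in the cell's staging area (p2 `CHECK_MEGA_FINAL`, p3 `CHECK_MEGA_TheoremA_min`, 2026-08-25,
c₁ = 2^70, c₂ = 1, r = 0) and are being landed file by file. Until the tree proves it, routes use it only as
their own item / conditional premise (human rule 2026-08-15: unproven conjectures live in our theories).

WHAT THIS IS NOT: not a Literature fact, not a proof; proving `TheoremAOne` (a theorem of this exact type) closes
item stmt-ABC-19165 and discharges the conditional bridge of route PadicPrincipalCoreRadThree.
-/

namespace Summit.ABC.ABC.Theorems.PadicTheoremAOne

open Finset

/-- **Theorem A₁** (p-adic Waldschmidt-1980 bound for principal units of ℚ, envelope exponent c₂ ≤ 1) — open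
named conjecture of this programme; verbatim the route item `PadicPrincipalCoreST86.TheoremAOne`. Transposes the
archimedean theorem of [cite: Waldschmidt1980, Théorème p. 257] to the p-adic principal-unit setting of
[cite: Yu1989, §2]. -/
@[conjecture]
def TheoremAOne : Prop := ∃ (C : ℕ → ℝ) (r : ℕ → ℕ) (c₁ c₂ : ℝ), 1 ≤ c₁ ∧ 0 ≤ c₂ ∧ c₂ ≤ 1 ∧ (∀ m, 0 ≤ C m ∧ C m ≤ c₁ ^ m * (m : ℝ) ^ (c₂ * m)) ∧ (∀ (p : ℕ), p.Prime → p ≠ 2 → ∀ (m : ℕ) (α : Fin m → ℚ) (b : Fin m → ℤ) (V : Fin m → ℝ) (Vmax W : ℝ), (∀ j, α j ≠ 0 ∧ 1 ≤ padicValRat p (α j - 1)) → (∀ μ : Fin m → ℤ, ∏ j, α j ^ μ j = 1 → μ = 0) → (∀ T : Finset (Fin m), T.Nonempty → ¬ IsSquare (∏ j ∈ T, α j)) → (∀ j, Height.logHeight₁ (α j) ≤ V j) → (∀ j, Real.log p ≤ V j) → (∀ j, V j ≤ Vmax) → b ≠ 0 → (∀ j, Real.log (max 3 (|b j| : ℝ))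 ≤ W) → (padicValRat p (∏ j, α j ^ b j - 1) : ℝ) * Real.log p ≤ C m * (∏ j, V j) * (W + Real.log (2 * Vmax)) * Real.log (2 * Vmax) / Real.log p ^ r m)

end Summit.ABC.ABC.Theorems.PadicTheoremAOne
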